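import Summits.QuantumFields.BalabanUV.T4Continuum.Support.AveragingDeficitCoreAxialPrep

/-!
# AveragingDeficitCoreAxial (T⁴ programme, node NE3, row NE3-R2) — THE PER-PLAQUETTE CORE ESTIMATE IN THE AXIAL GAUGE
# (file 2/2): `core_axial` — for a `U(N)`-valued small-field configuration with the axial bound `‖V(b) − 1‖ ≤ |b₋ − y_c|₁·a`
# of B7 p. 24 around the far corner of the coarse plaquette and a `𝔲(N)` direction,
# `|t_P + L^{2−d}·Σ_k Re tr((d_Vψ)(p_k)F(p_k))| ≤ coreC₁·SG·SF + coreC₂·a²·(Sψ + SG)` (layers (W)+(DL)+(M) assembled)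

Honest framing, citation header, placement: header of `AveragingDeficitCoreAxialPrep` / `AveragingDeficitDerivCore` (unit
`b2b-balaban-t4-ne3r2-p1`, row NE3-R2; β = `DeficitDerivWall` NOT proved in this file — the gauge step and β are file
`AveragingDeficitDerivWallProof`; [folklore] bookkeeping on the tree's transcriptions of B7 (42)/(44)/(47)–(50); `[cite:]`
tags are CONTEXT; NE3 COND-free; finite-T⁴ rung (B)+1, not Clay).  Record: HOME `t4/T4-EST-NE3-R2.md`.
-/

set_option autoImplicit false

open scoped BigOperators Matrix Matrix.Norms.L2Operator Topology
open NormedSpace Finset Filter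

namespace Summit.QuantumFields.BalabanUV.T4Continuum.AveragingDeficitCoreAxial

open Literature.MathematicalPhysics.QuantumFieldTheory.Balaban1983to89
open B7Prop1Explicit B7Prop2Explicit MatrixLog UnitaryModel
open T4AveragingDeficitWall hiding Site Plane Plaq Bond
open T4AveragingDeficitWallBoundary (stencilIdx stencilOff card_stencilIdx)
open T4AveragingDeficitNonAbelian (Ad_mul Ad_sub fluxAvg fluxLinearisation fluxAvg_eq_sum_idx)
open AveragingDeficitTransport AveragingDeficitLocality AveragingDeficitNearIdentity AveragingDeficitCounting
open AveragingDeficitSideDeriv AveragingDeficitPlaqDeriv AveragingDeficitDerivCore AveragingDeficitPlaqLin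
open AveragingDeficitPlaqLinBound AveragingDeficitCoreAxialPrep

noncomputable section

variable {d : ℕ} {n : Type*} [Fintype n] [DecidableEq n] [Nonempty n]

local notation "𝕄" => Matrix n n ℂ
local notation "Site" => B7Prop1Explicit.Site
local notation "Plane" => T4AveragingDeficitWall.Plane
local notation "Plaq" => T4AveragingDeficitWall.Plaq

/-! ## §4 The core estimate in the axial gauge -/

/-- The core constant `c₁ = 2(d+2)L³`. [folklore] -/
def coreC₁ (d L : ℕ) : ℝ := 2 * ((d + 2) * L) * (L : ℝ) ^ 2

/-- The core constant `c₂`. [folklore] -/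
def coreC₂ (d L : ℕ) : ℝ :=
  2 * (2 * ((d + 2) * L) * ((coreRad d L : ℝ) + 2 * L)) * 2 * (L : ℝ) ^ 2
    + 325 * (8 * (d + 1) * (d + 4) * (L : ℝ) ^ 2) ^ 2
    + plaqLinConst d L * ((reach d L : ℝ) + 2 * L) * (2 * (L : ℝ) ^ 2 + 325 * (8 * (d + 1) * (d + 4) * (L : ℝ) ^ 2) ^ 2)

omit [Fintype n] [DecidableEq n] [Nonempty n] in
/-- `coreC₁ ≥ 0`, `coreC₂ ≥ 0`. [folklore] -/
theorem coreC_nonneg (d L : ℕ) : 0 ≤ coreC₁ d L ∧ 0 ≤ coreC₂ d L := by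
  have h1 : 0 ≤ plaqLinConst d L := by
    unfold plaqLinConst sideDevConst sideNormConst sideLinConst; positivity
  unfold coreC₁ coreC₂
  exact ⟨by positivity, by positivity⟩

/-- Real bookkeeping for `core_axial`. [folklore] -/
private theorem core_aux {a Lz c SG BG S PLC r₁ r₂ κ X Y Z L2 dd : ℝ} (ha : 0 ≤ a) (ha1 : a ≤ 1)
    (hSG : 0 ≤ SG) (hBG : 0 ≤ BG) (hS : 0 ≤ S) (hPLC : 0 ≤ PLC) (hr₁ : 0 ≤ r₁) (hr₂ : 0 ≤ r₂)
    (hL2 : 0 ≤ L2) (hdd : 0 ≤ dd) (hLzle : Lz ≤ L2) (hc1 : c ≤ 1)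
    (hX : X ≤ Lz * (dd * BG + 2 * (dd * (r₂ * a)) * (2 * a)) * SG)
    (hY : Y ≤ PLC * (r₁ * a) * S * (2 * L2 * a))
    (hZ : Z ≤ (c * SG + PLC * (r₁ * a) * S) * (325 * (κ * a) ^ 2)) :
    X + Y + Z ≤ dd * L2 * SG * BG
      + (2 * (dd * r₂) * 2 * L2 + 325 * κ ^ 2 + PLC * r₁ * (2 * L2 + 325 * κ ^ 2)) * a ^ 2 * (S + SG) := by
  have h1 : Lz * (dd * BG) * SG ≤ L2 * (dd * BG) * SG :=
    mul_le_mul_of_nonneg_right (mul_le_mul_of_nonneg_right hLzle (by positivity)) hSG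
  have h2 : Lz * (2 * (dd * (r₂ * a)) * (2 * a)) * SG ≤ L2 * (2 * (dd * (r₂ * a)) * (2 * a)) * SG :=
    mul_le_mul_of_nonneg_right (mul_le_mul_of_nonneg_right hLzle (by positivity)) hSG
  have h3 : c * SG * (325 * (κ * a) ^ 2) ≤ 1 * SG * (325 * (κ * a) ^ 2) :=
    mul_le_mul_of_nonneg_right (mul_le_mul_of_nonneg_right hc1 hSG) (by positivity)
  have h4 : PLC * (r₁ * a) * S * (325 * (κ * a) ^ 2) ≤ PLC * r₁ * S * (325 * κ ^ 2) * a ^ 2 * 1 := by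
    have : PLC * (r₁ * a) * S * (325 * (κ * a) ^ 2) = PLC * r₁ * S * (325 * κ ^ 2) * a ^ 2 * a := by ring
    rw [this]
    exact mul_le_mul_of_nonneg_left ha1 (by positivity)
  have h5 : 0 ≤ (2 * (dd * r₂) * 2 * L2 + 325 * κ ^ 2) * a ^ 2 * S := by positivity
  have h6 : 0 ≤ PLC * r₁ * (2 * L2 + 325 * κ ^ 2) * a ^ 2 * SG := by positivity
  nlinarith

/-- **THE CORE ESTIMATE IN THE AXIAL GAUGE** (layers (W) + (DL) + (M)): for a `U(N)`-valued `V` with (44)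
`|V(∂p) − 1| ≤ a`, `512(d+1)(d+4)L²a ≤ 1`, in the axial gauge around the far corner of the coarse plaquette `(y, π)`
(`‖V(b) − 1‖ ≤ |b₋ − y_c|₁·a`), a `𝔲(N)` direction `ψ` and any derivative `t` of `s ↦ wt(\overline{V e^{sψ}}(∂P))` at `0`:
`|t + L^{2−d}·stencilPair| ≤ coreC₁·stencilCurlL1·boxGradL1(coreRad) + coreC₂·a²·(dirL1(box coreRad) + stencilCurlL1)`.
[cite: Balaban1985Averaging, (42) p.23, (44)–(45) p.24, (47)–(50) p.25] -/
theorem core_axial (L : ℕ) (hL : 1 ≤ L) {V : Site d → Fin d → 𝕄ˣ} (hV : IsUnitaryCfg V) {a : ℝ} (ha : 0 ≤ a)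
    (hsmall : 512 * (d + 1) * (d + 4) * (L : ℝ) ^ 2 * a ≤ 1) (hVa : SmallField V a)
    {ψ : Site d → Fin d → 𝕄} (hψ : IsSkewDir ψ) (y : Site d) (π : Plane d)
    (hbond : ∀ (x : Site d) (κ : Fin d),
      ‖((V x κ : 𝕄ˣ) : 𝕄) - 1‖ ≤ l1 (x - ((L : ℤ) • y + (L : ℤ) • e π.1.1 + (L : ℤ) • e π.1.2)) * a)
    {t : ℝ} (ht : HasDerivAt (fun s : ℝ => wt (chol L (vary V ψ s) (y, π))) t 0) :
    |t + (L : ℝ) ^ ((2 : ℤ) - d) * stencilPair L V ψ y π|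
      ≤ coreC₁ d L * stencilCurlL1 L V ψ y π * boxGradL1 L V (coreRad d L) y π
        + coreC₂ d L * a ^ 2 * (dirL1 ψ (box (coreRad d L) ((L : ℤ) • y)) + stencilCurlL1 L V ψ y π) := by
  letI : CStarAlgebra 𝕄 := {}
  set z : Site d := (L : ℤ) • y with hz
  set μ : Fin d := π.1.1 with hμ
  set ν : Fin d := π.1.2 with hν
  have hμν : μ ≠ ν := ne_of_lt π.2
  have hd : 1 ≤ d := Nat.succ_le_of_lt μ.pos
  have hL0 : (0 : ℝ) < L := by exact_mod_cast hL
  set θ : ℝ := 8 * (d + 1) * (d + 4) * (L : ℝ) ^ 2 * a with hθ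
  have hθ1 : θ ≤ 1 / 64 := by
    have : 64 * θ = 512 * (d + 1) * (d + 4) * (L : ℝ) ^ 2 * a := by rw [hθ]; ring
    linarith
  have hθ0 : 0 ≤ θ := by positivity
  have ha512 := T4AveragingDeficitNonAbelian.small_a_le hL hd ha hsmall
  have ha1 : a ≤ 1 / 4 := ha512.trans (by norm_num)
  have ha1' : a ≤ 1 := ha512.trans (by norm_num)
  -- loop variables: all within `2θ ≤ 1/32` (tree, gauge-free)
  have hU : ∀ x κ, V x κ ∈ U1 𝕄 := fun x κ => mem_U1_of_unitary (hV x κ)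
  have hW4 : ∀ (q : Site d) (κ : Fin d) (r : Fin d → Fin L), ‖((Wcx L V q κ (boxVec L r) : 𝕄ˣ) : 𝕄) - 1‖ < 1 / 4 :=
    fun q κ r => (norm_Wcx_sub_one_le L hL V hU ha hsmall hVa q κ r).trans_lt (by linarith)
  -- (W): `t = −Re tr(Ω (C − 1))`, `C − 1 = Θ + E`
  have ht' := deriv_wt_chol_eq L hV hψ y π hW4 ht
  set Ω := plaqOmega L V ψ z μ ν with hΩ
  set C : 𝕄 := ((chol L V (y, π) : 𝕄ˣ) : 𝕄) with hC
  have hCeq : C = ((cplaq L (bavg L V) z μ ν : 𝕄ˣ) : 𝕄) := rfl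
  obtain ⟨hE, hΘ⟩ := coarse_minus_one_linearisation L hL z V ha hsmall (fun x => hVa x μ ν hμν) hbond
  rw [← hCeq] at hE
  set Θ := fluxAvg L V z μ ν with hΘdef
  -- regions
  have hR : RegionBound V z (reach d L) (((reach d L : ℕ) + 2 * L) * a) := regionBound_of_axial L ha hbond _
  have hR' : RegionBound V z (coreRad d L) (((coreRad d L : ℕ) + 2 * L) * a) := regionBound_of_axial L ha hbond _
  have hβw := region_small L hL ha hsmall (d := d)
  -- (DL)
  have hDL := norm_plaqOmega_sub_omegaLin_le L hL hV ψ hR hβw μ ν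
  set Ω₀ := omegaLin L V ψ z μ ν with hΩ₀
  set S := dirL1 ψ (box (coreRad d L) z) with hS
  have hS0 : 0 ≤ S := dirL1_nonneg ψ _
  have hSmono : dirL1 ψ (box (reach d L) z) ≤ S :=
    Finset.sum_le_sum_of_subset_of_nonneg (box_mono (coreRad_ge d L).1 z)
      fun _ _ _ => Finset.sum_nonneg fun _ _ => norm_nonneg _
  have hPLC : 0 ≤ plaqLinConst d L := by unfold plaqLinConst sideDevConst sideNormConst sideLinConst; positivity
  have hDL' : ‖Ω - Ω₀‖ ≤ plaqLinConst d L * ((((reach d L : ℕ) : ℝ) + 2 * L) * a) * S :=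
    hDL.trans (mul_le_mul_of_nonneg_left hSmono (by positivity))
  -- `‖Ω₀‖ ≤ L^{−d}·SG`
  set c : ℝ := ((L : ℝ) ^ d)⁻¹ with hc
  have hc0 : 0 ≤ c := by positivity
  have hc1 : c ≤ 1 := inv_le_one_of_one_le₀ (one_le_pow₀ (by exact_mod_cast hL))
  set SG := stencilCurlL1 L V ψ y π with hSG
  have hSG0 : 0 ≤ SG := stencilCurlL1_nonneg L V ψ y π
  have hΩ₀n : ‖Ω₀‖ ≤ c * SG := by
    rw [hΩ₀, hSG]; unfold omegaLin stencilCurlL1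
    rw [Finset.mul_sum]
    refine (norm_sum_le _ _).trans (Finset.sum_le_sum fun k _ => ?_)
    rw [norm_smul, Real.norm_of_nonneg hc0]
    exact le_rfl
  -- `Θ = c • Σ_k F_k` and the main term
  have hΘeq : Θ = c • ∑ k ∈ stencilIdx d L, flux V (stencilPlaq L y π k) := by
    rw [hΘdef, fluxAvg_eq_sum_idx, Complex.coe_smul]; rfl
  have hΩ₀eq : Ω₀ = c • ∑ k ∈ stencilIdx d L, curl V ψ (stencilPlaq L y π k) := by
    rw [hΩ₀]; unfold omegaLin; rw [← Finset.smul_sum]; rfl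
  have hmain : nReTr (Ω₀ * Θ) = c * c * ∑ k ∈ stencilIdx d L, ∑ k' ∈ stencilIdx d L,
      nReTr (curl V ψ (stencilPlaq L y π k) * flux V (stencilPlaq L y π k')) := by
    rw [hΘeq, hΩ₀eq, smul_mul_assoc, mul_smul_comm, Finset.sum_mul_sum, ← nReTrL_apply, map_smul, map_smul, map_sum]
    simp only [smul_eq_mul, nReTrL_apply, mul_assoc]
    congr 1; congr 1
    exact Finset.sum_congr rfl fun k _ => by rw [← nReTrL_apply, map_sum]; rfl
  have hzpow : c * c * (L : ℝ) ^ (d + 2) = (L : ℝ) ^ ((2 : ℤ) - d) := by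
    rw [show ((2 : ℤ) - d) = (2 : ℤ) + (-(d : ℤ)) by ring, zpow_add₀ hL0.ne', zpow_neg, zpow_natCast, zpow_ofNat, hc,
      pow_add]
    field_simp
  have hM := double_sum_telescope L hV ψ y π ha1 hVa hR'
  -- `|Re tr(Ω₀Θ) − L^{2−d} SP| ≤ L^{2−d} Δ SG`
  set Δ := 2 * ((d + 2) * L) * boxGradL1 L V (coreRad d L) y π
    + 2 * (2 * ((d + 2) * L) * ((((coreRad d L : ℕ) : ℝ) + 2 * L) * a)) * (2 * a) with hΔ
  have hX : |nReTr (Ω₀ * Θ) - (L : ℝ) ^ ((2 : ℤ) - d) * stencilPair L V ψ y π|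
      ≤ (L : ℝ) ^ ((2 : ℤ) - d) * Δ * SG := by
    rw [hmain, ← hzpow]
    have e : c * c * (∑ k ∈ stencilIdx d L, ∑ k' ∈ stencilIdx d L,
          nReTr (curl V ψ (stencilPlaq L y π k) * flux V (stencilPlaq L y π k')))
        - c * c * (L : ℝ) ^ (d + 2) * stencilPair L V ψ y π
        = (c * c) * ((∑ k ∈ stencilIdx d L, ∑ k' ∈ stencilIdx d L,
          nReTr (curl V ψ (stencilPlaq L y π k) * flux V (stencilPlaq L y π k')))
          - (L : ℝ) ^ (d + 2) * stencilPair L V ψ y π) := by ring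
    rw [e, abs_mul, abs_of_nonneg (mul_nonneg hc0 hc0)]
    calc c * c * |(∑ k ∈ stencilIdx d L, ∑ k' ∈ stencilIdx d L,
            nReTr (curl V ψ (stencilPlaq L y π k) * flux V (stencilPlaq L y π k')))
          - (L : ℝ) ^ (d + 2) * stencilPair L V ψ y π|
        ≤ c * c * ((L : ℝ) ^ (d + 2) * Δ * SG) := mul_le_mul_of_nonneg_left hM (mul_nonneg hc0 hc0)
      _ = c * c * (L : ℝ) ^ (d + 2) * Δ * SG := by ring
  -- the two remainders
  have hY : |nReTr ((Ω - Ω₀) * Θ)| ≤ plaqLinConst d L * ((((reach d L : ℕ) : ℝ) + 2 * L) * a) * S * (2 * (L : ℝ) ^ 2 * a) :=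
    (abs_nReTr_mul_le _ _).trans (mul_le_mul hDL' hΘ (norm_nonneg _) (by positivity))
  have hZ : |nReTr (Ω * (C - 1 - Θ))| ≤ (c * SG + plaqLinConst d L * ((((reach d L : ℕ) : ℝ) + 2 * L) * a) * S)
      * (325 * θ ^ 2) := by
    refine (abs_nReTr_mul_le _ _).trans (mul_le_mul ?_ hE (norm_nonneg _) (by positivity))
    calc ‖Ω‖ ≤ ‖Ω₀‖ + ‖Ω - Ω₀‖ := by
          have := norm_add_le Ω₀ (Ω - Ω₀); rwa [add_sub_cancel] at this
      _ ≤ _ := add_le_add hΩ₀n hDL'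
  -- the identity for `t + L^{2−d} SP`
  have hid : t + (L : ℝ) ^ ((2 : ℤ) - d) * stencilPair L V ψ y π
      = -(nReTr (Ω₀ * Θ) - (L : ℝ) ^ ((2 : ℤ) - d) * stencilPair L V ψ y π)
        - nReTr ((Ω - Ω₀) * Θ) - nReTr (Ω * (C - 1 - Θ)) := by
    rw [ht']
    have e : Ω * (C - 1) = Ω₀ * Θ + (Ω - Ω₀) * Θ + Ω * (C - 1 - Θ) := by noncomm_ring
    rw [e, ← nReTrL_apply, ← nReTrL_apply, ← nReTrL_apply, ← nReTrL_apply, map_add, map_add]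
    ring
  rw [hid]
  have htri : |-(nReTr (Ω₀ * Θ) - (L : ℝ) ^ ((2 : ℤ) - d) * stencilPair L V ψ y π)
        - nReTr ((Ω - Ω₀) * Θ) - nReTr (Ω * (C - 1 - Θ))|
      ≤ |nReTr (Ω₀ * Θ) - (L : ℝ) ^ ((2 : ℤ) - d) * stencilPair L V ψ y π|
        + |nReTr ((Ω - Ω₀) * Θ)| + |nReTr (Ω * (C - 1 - Θ))| := by
    refine (abs_sub _ _).trans (add_le_add ((abs_sub _ _).trans (add_le_add (le_of_eq (abs_neg _)) le_rfl)) le_rfl)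
  refine htri.trans ?_
  -- real bookkeeping
  have hLzle : (L : ℝ) ^ ((2 : ℤ) - d) ≤ (L : ℝ) ^ 2 := by
    have e : (L : ℝ) ^ ((2 : ℤ) - d) = c * (L : ℝ) ^ 2 := by
      rw [← hzpow, hc, pow_add]; field_simp
    rw [e]
    exact mul_le_of_le_one_left (by positivity) hc1
  rw [hΔ] at hX
  rw [hθ] at hZ
  have key := core_aux (dd := 2 * (((d : ℝ) + 2) * L)) (κ := 8 * (d + 1) * (d + 4) * (L : ℝ) ^ 2) ha ha1' hSG0
    (boxGradL1_nonneg L V _ y π) hS0 hPLC (by positivity) (by positivity) (by positivity) (by positivity)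
    hLzle hc1 hX hY hZ
  refine key.trans (le_of_eq ?_)
  unfold coreC₁ coreC₂
  ring

end

end Summit.QuantumFields.BalabanUV.T4Continuum.AveragingDeficitCoreAxial
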